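import Summits.Ventures.Crystal3D.Theorems.StickyWulffConstantNoReconstructionGainCapCount
import HarnessLib

/-!
# The gain bound at every normal: substrate contacts ≤ film deficiency + (interstitial bonds − vacant registered down-slots) + O(ρ)

HONEST FRAMING. Part of the venture `Summits/Ventures/Crystal3D` (cell `crystal3d-full`), helper
`--supports` the crux `NoReconstructionGain` (stmt-Ventures-19144, route
`route-Ventures-StickyWulffConstant`), line `adhesion` (wulff-p1 g10).  The lattice LINE ARGUMENT
(`…LatticeAdhesion`: every cross contact starts a run of film balls along a bond line whose far end
is a vacant slot) generalises to ARBITRARY films once "run along a bond line" is replaced by "chain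
of contacts each within `30°` of a fixed bond direction `d` of the substrate lattice": two unit
vectors within `30°` of the same `d` are `< 1` apart, so in a unit packing every ball has at most one
contact in each of the twelve open `30°`-caps (`…CapLocal`).  Sending one unit of charge along
every REGISTERED contact (from the ball in whose down-cap it lies to the ball above it) and one unit
along every INTERSTITIAL contact (registered to no direction) from the `ν`-lower to the `ν`-upper
ball, the per-ball budget closes (`…CapCount`) and the transfers telescope:

* `interstitialGain_slab` (**rung**, registered by name; `R = 2`, `C = 768`): for every
  twelve-element set `U` of unit vectors of `Λ₀` closed under negation (the bond star), every unit
  `ν`, `ρ ≥ 2`, every finite unit packing `X ⊇ P` (`P` the `ν`-slab sample) with the film above the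
  cut,
  `#cross(P, X∖P) ≤ D(X∖P) + Σ_{q ∈ X∖P} [ a(q) − v(q) ] + 768 ρ`,
  where `a(q) = #{interstitial substrate contacts of q} + #{interstitial film contacts ν-below q}
  + ½ #{interstitial film contacts ν-level with q}` and `v(q) = #{d ∈ U : ⟪d,ν⟫ < 0, no contact of
  q in the cap of d} + ½ #{d ∈ U : ⟪d,ν⟫ = 0, no contact of q in the cap of d}`.

* `interstitialGain_lower` — the REVERSE inequality `#cross(P, X∖P) ≥ D(X∖P) + Σ_q [a(q) − v(q)]`
  for EVERY finite unit packing `X ⊇ P` (no slab, no cut, any `ν`): the transfer is exact.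

So any continuation GAIN of a film is carried by its interstitial bonds, at most one unit per bond,
and every vacant registered down-slot of a film ball takes one unit back; the two inequalities
together say this is the whole content of the crux in cap currency: the atom `stub_adhesion` ⟺
`Σ_q a(q) ≤ Σ_q v(q) + O(ρ)` for every film above the cut.  Corollaries (per-ball rule,
bond-orientationally registered films) are in `…InterstitialRules`.

WHAT THIS IS NOT: no bound on the number of interstitial bonds of an arbitrary film — that is the
crux; rung F-C1 not moved.
-/

noncomputable section

namespace Summit.Ventures.Crystal3D.Theorems

open Summit.Ventures.Crystal3D Finset
open Literature.MathematicalPhysics.StatisticalMechanics (fccStacking orderedContacts contactDeficiency)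
open scoped InnerProductSpace

set_option maxHeartbeats 400000 in
/-- **The gain bound** (see the module docstring; registered by name on stmt-Ventures-19144). -/
theorem interstitialGain_slab :
    ∃ R C : ℝ, 1 ≤ R ∧ ∀ U : Finset (EuclideanSpace ℝ (Fin 3)),
      (∀ d ∈ U, d ∈ fccStacking 1 (Real.sqrt (2 / 3)) ∧ ‖d‖ = 1) → (∀ d ∈ U, -d ∈ U) → U.card = 12 →
      ∀ ν : EuclideanSpace ℝ (Fin 3), ‖ν‖ = 1 → ∀ ρ : ℝ, R ≤ ρ →
      ∀ X P : Finset (EuclideanSpace ℝ (Fin 3)),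
      (∀ p ∈ X, ∀ q ∈ X, p ≠ q → 1 ≤ dist p q) → P ⊆ X →
      (∀ p, p ∈ P ↔ (p ∈ fccStacking 1 (Real.sqrt (2 / 3)) ∧ -(2 * R) ≤ ⟪p, ν⟫_ℝ ∧
        ⟪p, ν⟫_ℝ ≤ -R ∧ ‖p‖ ^ 2 - ⟪p, ν⟫_ℝ ^ 2 ≤ ρ ^ 2)) →
      (∀ q ∈ X \ P, -R < ⟪q, ν⟫_ℝ) →
      ((((P ×ˢ (X \ P)).filter fun pq => dist pq.1 pq.2 = 1).card : ℕ) : ℝ) ≤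
        contactDeficiency (X \ P)
          + ∑ q ∈ X \ P,
            (((P.filter fun p => dist q p = 1 ∧ ∀ d ∈ U, ⟪p - q, d⟫_ℝ ≤ Real.sqrt 3 / 2).card : ℝ)
              + (((X \ P).filter fun x => dist q x = 1 ∧ (∀ d ∈ U, ⟪x - q, d⟫_ℝ ≤ Real.sqrt 3 / 2) ∧
                  ⟪x, ν⟫_ℝ < ⟪q, ν⟫_ℝ).card : ℝ)
              + (1 / 2) * (((X \ P).filter fun x => dist q x = 1 ∧ (∀ d ∈ U, ⟪x - q, d⟫_ℝ ≤ Real.sqrt 3 / 2) ∧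
                  ⟪x, ν⟫_ℝ = ⟪q, ν⟫_ℝ).card : ℝ)
              - ((U.filter fun d => ⟪d, ν⟫_ℝ < 0 ∧
                  ∀ x ∈ X, dist q x = 1 → ⟪x - q, d⟫_ℝ ≤ Real.sqrt 3 / 2).card : ℝ)
              - (1 / 2) * ((U.filter fun d => ⟪d, ν⟫_ℝ = 0 ∧
                  ∀ x ∈ X, dist q x = 1 → ⟪x - q, d⟫_ℝ ≤ Real.sqrt 3 / 2).card : ℝ))
          + C * ρ := by
  classical
  refine ⟨2, 768, by norm_num, ?_⟩
  intro U hU hUneg hUcard ν hν ρ hρ X P hX hPX hP habove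
  set c : ℝ := Real.sqrt 3 / 2 with hc
  -- per-ball quantities, as real numbers
  set cP : EuclideanSpace ℝ (Fin 3) → ℝ := fun q => ((P.filter fun p => dist q p = 1).card : ℝ) with hcP
  set dF : EuclideanSpace ℝ (Fin 3) → ℝ := fun q =>
    (((X \ P).filter fun x => dist q x = 1).card : ℝ) with hdF
  set g : EuclideanSpace ℝ (Fin 3) → EuclideanSpace ℝ (Fin 3) → ℤ := fun x y =>
    (if ∃ d ∈ U, ⟪d, ν⟫_ℝ < 0 ∧ c < ⟪x - y, d⟫_ℝ then (1 : ℤ) else 0)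
      + (if (∀ d ∈ U, ⟪x - y, d⟫_ℝ ≤ c) ∧ ⟪x, ν⟫_ℝ < ⟪y, ν⟫_ℝ then (1 : ℤ) else 0) with hg
  set t : EuclideanSpace ℝ (Fin 3) → EuclideanSpace ℝ (Fin 3) → ℤ := fun x y => g x y - g y x with ht
  have ht_anti : ∀ x y, t x y = -t y x := fun x y => by simp only [ht]; ring
  set S : EuclideanSpace ℝ (Fin 3) → ℝ := fun q =>
    ((∑ x ∈ (X \ P).filter (fun x => dist q x = 1), t x q : ℤ) : ℝ) with hS
  set f : EuclideanSpace ℝ (Fin 3) → ℝ := fun q =>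
    ((P.filter fun p => dist q p = 1 ∧ ∀ d ∈ U, ⟪p - q, d⟫_ℝ ≤ c).card : ℝ)
      + (((X \ P).filter fun x => dist q x = 1 ∧ (∀ d ∈ U, ⟪x - q, d⟫_ℝ ≤ c) ∧
          ⟪x, ν⟫_ℝ < ⟪q, ν⟫_ℝ).card : ℝ)
      + (1 / 2) * (((X \ P).filter fun x => dist q x = 1 ∧ (∀ d ∈ U, ⟪x - q, d⟫_ℝ ≤ c) ∧
          ⟪x, ν⟫_ℝ = ⟪q, ν⟫_ℝ).card : ℝ)
      - ((U.filter fun d => ⟪d, ν⟫_ℝ < 0 ∧ ∀ x ∈ X, dist q x = 1 → ⟪x - q, d⟫_ℝ ≤ c).card : ℝ)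
      - (1 / 2) * ((U.filter fun d => ⟪d, ν⟫_ℝ = 0 ∧ ∀ x ∈ X, dist q x = 1 → ⟪x - q, d⟫_ℝ ≤ c).card : ℝ)
    with hf
  set B : EuclideanSpace ℝ (Fin 3) → ℝ := fun q =>
    ((P.filter fun p => dist q p = 1 ∧ ∃ d ∈ U, 0 ≤ ⟪d, ν⟫_ℝ ∧ c < ⟪p - q, d⟫_ℝ).card : ℝ) with hB
  -- (1) the per-ball accounting, cast to `ℝ`
  have hkey : ∀ q ∈ X \ P, 2 * cP q + dF q + S q ≤ 12 + 2 * f q + 2 * B q := by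
    intro q hq
    have hK := perBall_capAccount X P hX hPX U hU hUneg hUcard ν q hq
    set T := ∑ x ∈ (X \ P).filter (fun x => dist q x = 1), t x q with hT
    rw [← hc] at hK
    have hK' := (Int.cast_le (R := ℝ)).2 hK
    simp only [hcP, hdF, hS, hf, hB, ← hT]
    push_cast at hK' ⊢
    linarith
  -- (2) the transfers telescope
  have hs0 : ∑ q ∈ X \ P, S q = 0 := by
    simp only [hS]
    rw [← Int.cast_sum, sum_sum_transfer_eq_zero (X \ P) t ht_anti, Int.cast_zero]
  -- (3) global identities
  have hcross : ((((P ×ˢ (X \ P)).filter fun pq => dist pq.1 pq.2 = 1).card : ℕ) : ℝ) =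
      ∑ q ∈ X \ P, cP q := card_cross_eq_sum_card_plug_partners P (X \ P)
  have hord : (orderedContacts (X \ P) : ℝ) = ∑ q ∈ X \ P, dF q :=
    orderedContacts_eq_sum_card_partners (X \ P)
  have hdef : contactDeficiency (X \ P) =
      6 * ((X \ P).card : ℝ) - (orderedContacts (X \ P) : ℝ) / 2 := rfl
  -- (4) the rim term: substrate balls holding an up-or-level cap are in the rim band
  set Pbad := P.filter fun p => (∃ q ∈ X \ P, dist p q = 1) ∧ ∃ d ∈ U, ⟪d, ν⟫_ℝ ≤ 0 ∧ p + d ∉ P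
    with hPbad
  have h12 : ∀ e, (X.filter fun x => dist e x = 1).card ≤ 12 := fun e => card_partners_le_twelve X hX e
  have hBq : ∀ q ∈ X \ P, B q ≤ ((Pbad.filter fun p => dist q p = 1).card : ℝ) := by
    intro q hq
    simp only [hB]
    have hsub : (P.filter fun p => dist q p = 1 ∧ ∃ d ∈ U, 0 ≤ ⟪d, ν⟫_ℝ ∧ c < ⟪p - q, d⟫_ℝ) ⊆
        Pbad.filter fun p => dist q p = 1 := by
      intro p hp
      obtain ⟨hpP, hqp, d, hdU, hdν, hpd⟩ := mem_filter.1 hp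
      refine mem_filter.2 ⟨mem_filter.2 ⟨hpP, ⟨q, hq, by rw [dist_comm]; exact hqp⟩, -d, hUneg d hdU,
        by rw [inner_neg_left]; linarith, fun hmem => ?_⟩, hqp⟩
      -- `p - d` would be a substrate ball at distance `< 1` from `q`
      have hu : ‖p - q‖ = 1 := by rw [← dist_eq_norm, dist_comm, hqp]
      have hlt : ‖(p - q) - d‖ < 1 := norm_sub_lt_one_of_cap hu (hU d hdU).2 hpd
      have hd' : dist q (p + -d) < 1 := by
        rw [dist_eq_norm, show q - (p + -d) = -((p - q) - d) by abel, norm_neg]; exact hlt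
      by_cases hne : q = p + -d
      · exact (mem_sdiff.1 hq).2 (hne ▸ hmem)
      · have := hX q (mem_sdiff.1 hq).1 (p + -d) (hPX hmem) hne
        linarith
    exact_mod_cast card_le_card hsub
  have hBsum : ∑ q ∈ X \ P, B q ≤ 12 * (Pbad.card : ℝ) := by
    have h1 : ∑ q ∈ X \ P, B q ≤ ∑ q ∈ X \ P, ((Pbad.filter fun p => dist q p = 1).card : ℝ) :=
      sum_le_sum hBq
    have h2 : ∑ q ∈ X \ P, ((Pbad.filter fun p => dist q p = 1).card : ℝ) =
        ∑ p ∈ Pbad, (((X \ P).filter fun q => dist p q = 1).card : ℝ) := by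
      have e1 : ∀ q ∈ X \ P, ((Pbad.filter fun p => dist q p = 1).card : ℝ) =
          ∑ p ∈ Pbad, if dist q p = 1 then (1 : ℝ) else 0 := fun q _ => by
        rw [card_filter, Nat.cast_sum]; simp only [Nat.cast_ite, Nat.cast_one, Nat.cast_zero]
      have e2 : ∀ p ∈ Pbad, (((X \ P).filter fun q => dist p q = 1).card : ℝ) =
          ∑ q ∈ X \ P, if dist q p = 1 then (1 : ℝ) else 0 := fun p _ => by
        rw [card_filter, Nat.cast_sum]
        simp only [Nat.cast_ite, Nat.cast_one, Nat.cast_zero, dist_comm]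
      rw [sum_congr rfl e1, sum_congr rfl e2, sum_comm]
    have h3 : ∑ p ∈ Pbad, (((X \ P).filter fun q => dist p q = 1).card : ℝ) ≤ ∑ p ∈ Pbad, (12 : ℝ) := by
      refine sum_le_sum fun p _ => ?_
      have := (card_le_card (filter_subset_filter (fun q => dist p q = 1) (sdiff_subset (s := X) (t := P)))).trans
        (h12 p)
      exact_mod_cast this
    rw [sum_const, nsmul_eq_mul] at h3
    linarith
  -- (5) the rim band has at most `64 ρ` substrate balls (as in `slabForm_of_localClosure`)
  have hband : ∀ p ∈ Pbad, (ρ - 1) ^ 2 ≤ ‖p‖ ^ 2 - ⟪p, ν⟫_ℝ ^ 2 ∧ ‖p‖ ^ 2 - ⟪p, ν⟫_ℝ ^ 2 ≤ ρ ^ 2 ∧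
      -3 < ⟪p, ν⟫_ℝ ∧ ⟪p, ν⟫_ℝ ≤ -2 := by
    intro p hp
    obtain ⟨hpP, ⟨q, hq, hdq⟩, d, hdU, hdν, hnd⟩ := mem_filter.1 hp
    obtain ⟨hpΛ, _, hpt, hplat⟩ := (hP p).1 hpP
    obtain ⟨hdΛ, hdn⟩ := hU d hdU
    have hpq : |⟪p - q, ν⟫_ℝ| ≤ 1 := by
      have h := abs_real_inner_le_norm (p - q) ν
      rw [hν, mul_one, ← dist_eq_norm, hdq] at h; exact h
    have hpt' : -3 < ⟪p, ν⟫_ℝ := by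
      have := habove q hq
      rw [inner_sub_left] at hpq
      have := (abs_le.1 hpq).1; linarith
    have hdν1 : -1 ≤ ⟪d, ν⟫_ℝ := by
      have h := abs_real_inner_le_norm d ν
      rw [hν, mul_one, hdn] at h
      have := (abs_le.1 h).1; linarith
    have hlat : ρ ^ 2 < ‖p + d‖ ^ 2 - ⟪p + d, ν⟫_ℝ ^ 2 := by
      by_contra hle
      push Not at hle
      refine hnd ((hP (p + d)).2 ⟨fcc_add_site_mem hpΛ hdΛ, ?_, ?_, hle⟩)
      · rw [inner_add_left]; linarith
      · rw [inner_add_left]; linarith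
    have hnorm : ∀ x : EuclideanSpace ℝ (Fin 3),
        ‖((ℝ ∙ ν)ᗮ).orthogonalProjectionOnto x‖ ^ 2 = ‖x‖ ^ 2 - ⟪x, ν⟫_ℝ ^ 2 := by
      intro x
      have e1 := Submodule.norm_sq_eq_add_norm_sq_projection x (ℝ ∙ ν)
      have e2' : ‖((ℝ ∙ ν).orthogonalProjectionOnto x : EuclideanSpace ℝ (Fin 3))‖ = |⟪x, ν⟫_ℝ| := by
        rw [Submodule.coe_orthogonalProjectionOnto_apply, Submodule.starProjection_singleton ℝ, norm_smul, hν,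
          real_inner_comm]
        simp
      have e2 : ‖(ℝ ∙ ν).orthogonalProjectionOnto x‖ = |⟪x, ν⟫_ℝ| := by rw [← e2', Submodule.coe_norm]
      rw [e2, sq_abs] at e1
      linarith
    have htri : ‖((ℝ ∙ ν)ᗮ).orthogonalProjectionOnto (p + d)‖ ≤
        ‖((ℝ ∙ ν)ᗮ).orthogonalProjectionOnto p‖ + ‖((ℝ ∙ ν)ᗮ).orthogonalProjectionOnto d‖ := by
      rw [map_add]; exact norm_add_le _ _
    have hyd : ‖((ℝ ∙ ν)ᗮ).orthogonalProjectionOnto d‖ ≤ 1 := by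
      have := hnorm d
      rw [hdn] at this
      nlinarith [norm_nonneg (((ℝ ∙ ν)ᗮ).orthogonalProjectionOnto d), sq_nonneg ⟪d, ν⟫_ℝ]
    have hypd : ρ < ‖((ℝ ∙ ν)ᗮ).orthogonalProjectionOnto (p + d)‖ := by
      have := hnorm (p + d)
      nlinarith [norm_nonneg (((ℝ ∙ ν)ᗮ).orthogonalProjectionOnto (p + d))]
    have hyp : ρ - 1 ≤ ‖((ℝ ∙ ν)ᗮ).orthogonalProjectionOnto p‖ := by linarith
    have hyp2 := hnorm p
    refine ⟨?_, hplat, hpt', hpt⟩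
    nlinarith
  have hPbadcard : (Pbad.card : ℝ) ≤ 64 * ρ := by
    set P1 := Pbad.filter fun p => ⟪p, ν⟫_ℝ ≤ -(5 / 2) with hP1
    set P2 := Pbad.filter fun p => ¬ ⟪p, ν⟫_ℝ ≤ -(5 / 2) with hP2
    have hsplit : Pbad.card = P1.card + P2.card := by
      rw [hP1, hP2, card_filter_add_card_filter_not]
    have hsep : ∀ S' : Finset (EuclideanSpace ℝ (Fin 3)), S' ⊆ Pbad → ∀ p ∈ S', ∀ q ∈ S', p ≠ q → 1 ≤ dist p q :=
      fun S' hS p hp q hq hpq => hX p (hPX (mem_filter.1 (hS hp)).1) q (hPX (mem_filter.1 (hS hq)).1) hpq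
    have h1' := card_shellBand_le ν hν P1 (hsep P1 (filter_subset _ _)) ρ 1 (-3) (by norm_num) (by linarith)
      (fun x hx => by
        obtain ⟨hxB, hxt⟩ := mem_filter.1 hx
        obtain ⟨a1, a2, a3, a4⟩ := hband x hxB
        exact ⟨a1, a2, by linarith, by linarith⟩)
    have h2' := card_shellBand_le ν hν P2 (hsep P2 (filter_subset _ _)) ρ 1 (-(5 / 2)) (by norm_num) (by linarith)
      (fun x hx => by
        obtain ⟨hxB, hxt⟩ := mem_filter.1 hx
        obtain ⟨a1, a2, a3, a4⟩ := hband x hxB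
        exact ⟨a1, a2, by linarith, by linarith⟩)
    have : (Pbad.card : ℝ) = P1.card + P2.card := by exact_mod_cast hsplit
    linarith
  -- (6) assemble
  have hsumkey : ∑ q ∈ X \ P, (2 * cP q + dF q + S q) ≤ ∑ q ∈ X \ P, (12 + 2 * f q + 2 * B q) :=
    sum_le_sum hkey
  simp only [sum_add_distrib, sum_const, nsmul_eq_mul, ← mul_sum] at hsumkey
  rw [hcross, hdef, hord]
  have hfsum : ∑ q ∈ X \ P, f q = ∑ q ∈ X \ P,
      (((P.filter fun p => dist q p = 1 ∧ ∀ d ∈ U, ⟪p - q, d⟫_ℝ ≤ Real.sqrt 3 / 2).card : ℝ)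
        + (((X \ P).filter fun x => dist q x = 1 ∧ (∀ d ∈ U, ⟪x - q, d⟫_ℝ ≤ Real.sqrt 3 / 2) ∧
            ⟪x, ν⟫_ℝ < ⟪q, ν⟫_ℝ).card : ℝ)
        + (1 / 2) * (((X \ P).filter fun x => dist q x = 1 ∧ (∀ d ∈ U, ⟪x - q, d⟫_ℝ ≤ Real.sqrt 3 / 2) ∧
            ⟪x, ν⟫_ℝ = ⟪q, ν⟫_ℝ).card : ℝ)
        - ((U.filter fun d => ⟪d, ν⟫_ℝ < 0 ∧
            ∀ x ∈ X, dist q x = 1 → ⟪x - q, d⟫_ℝ ≤ Real.sqrt 3 / 2).card : ℝ)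
        - (1 / 2) * ((U.filter fun d => ⟪d, ν⟫_ℝ = 0 ∧
            ∀ x ∈ X, dist q x = 1 → ⟪x - q, d⟫_ℝ ≤ Real.sqrt 3 / 2).card : ℝ)) := by
    rfl
  rw [← hfsum]
  linarith [hsumkey, hs0, hBsum, hPbadcard]

/-- **The gain bound is exact: the reverse inequality, with no slab hypothesis.**  For every finite
unit packing `X`, every `P ⊆ X`, every direction `ν` and every bond star `U`,
`#cross(P, X∖P) ≥ D(X∖P) + Σ_{q ∈ X∖P} [ a(q) − v(q) ]` — so `interstitialGain_slab` loses only its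
rim term, and the atom of the crux is EQUIVALENT to `Σ_q a(q) ≤ Σ_q v(q) + O(ρ)` over the film. -/
theorem interstitialGain_lower (X P : Finset (EuclideanSpace ℝ (Fin 3)))
    (hX : ∀ p ∈ X, ∀ q ∈ X, p ≠ q → 1 ≤ dist p q) (hPX : P ⊆ X)
    (U : Finset (EuclideanSpace ℝ (Fin 3)))
    (hU : ∀ d ∈ U, d ∈ fccStacking 1 (Real.sqrt (2 / 3)) ∧ ‖d‖ = 1) (hUneg : ∀ d ∈ U, -d ∈ U)
    (hUcard : U.card = 12) (ν : EuclideanSpace ℝ (Fin 3)) :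
    contactDeficiency (X \ P)
        + ∑ q ∈ X \ P,
          (((P.filter fun p => dist q p = 1 ∧ ∀ d ∈ U, ⟪p - q, d⟫_ℝ ≤ Real.sqrt 3 / 2).card : ℝ)
            + (((X \ P).filter fun x => dist q x = 1 ∧ (∀ d ∈ U, ⟪x - q, d⟫_ℝ ≤ Real.sqrt 3 / 2) ∧
                ⟪x, ν⟫_ℝ < ⟪q, ν⟫_ℝ).card : ℝ)
            + (1 / 2) * (((X \ P).filter fun x => dist q x = 1 ∧ (∀ d ∈ U, ⟪x - q, d⟫_ℝ ≤ Real.sqrt 3 / 2) ∧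
                ⟪x, ν⟫_ℝ = ⟪q, ν⟫_ℝ).card : ℝ)
            - ((U.filter fun d => ⟪d, ν⟫_ℝ < 0 ∧
                ∀ x ∈ X, dist q x = 1 → ⟪x - q, d⟫_ℝ ≤ Real.sqrt 3 / 2).card : ℝ)
            - (1 / 2) * ((U.filter fun d => ⟪d, ν⟫_ℝ = 0 ∧
                ∀ x ∈ X, dist q x = 1 → ⟪x - q, d⟫_ℝ ≤ Real.sqrt 3 / 2).card : ℝ)) ≤
      ((((P ×ˢ (X \ P)).filter fun pq => dist pq.1 pq.2 = 1).card : ℕ) : ℝ) := by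
  classical
  set c : ℝ := Real.sqrt 3 / 2 with hc
  set cP : EuclideanSpace ℝ (Fin 3) → ℝ := fun q => ((P.filter fun p => dist q p = 1).card : ℝ) with hcP
  set dF : EuclideanSpace ℝ (Fin 3) → ℝ := fun q =>
    (((X \ P).filter fun x => dist q x = 1).card : ℝ) with hdF
  set g : EuclideanSpace ℝ (Fin 3) → EuclideanSpace ℝ (Fin 3) → ℤ := fun x y =>
    (if ∃ d ∈ U, ⟪d, ν⟫_ℝ < 0 ∧ c < ⟪x - y, d⟫_ℝ then (1 : ℤ) else 0)
      + (if (∀ d ∈ U, ⟪x - y, d⟫_ℝ ≤ c) ∧ ⟪x, ν⟫_ℝ < ⟪y, ν⟫_ℝ then (1 : ℤ) else 0) with hg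
  set t : EuclideanSpace ℝ (Fin 3) → EuclideanSpace ℝ (Fin 3) → ℤ := fun x y => g x y - g y x with ht
  have ht_anti : ∀ x y, t x y = -t y x := fun x y => by simp only [ht]; ring
  set S : EuclideanSpace ℝ (Fin 3) → ℝ := fun q =>
    ((∑ x ∈ (X \ P).filter (fun x => dist q x = 1), t x q : ℤ) : ℝ) with hS
  set f : EuclideanSpace ℝ (Fin 3) → ℝ := fun q =>
    ((P.filter fun p => dist q p = 1 ∧ ∀ d ∈ U, ⟪p - q, d⟫_ℝ ≤ c).card : ℝ)
      + (((X \ P).filter fun x => dist q x = 1 ∧ (∀ d ∈ U, ⟪x - q, d⟫_ℝ ≤ c) ∧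
          ⟪x, ν⟫_ℝ < ⟪q, ν⟫_ℝ).card : ℝ)
      + (1 / 2) * (((X \ P).filter fun x => dist q x = 1 ∧ (∀ d ∈ U, ⟪x - q, d⟫_ℝ ≤ c) ∧
          ⟪x, ν⟫_ℝ = ⟪q, ν⟫_ℝ).card : ℝ)
      - ((U.filter fun d => ⟪d, ν⟫_ℝ < 0 ∧ ∀ x ∈ X, dist q x = 1 → ⟪x - q, d⟫_ℝ ≤ c).card : ℝ)
      - (1 / 2) * ((U.filter fun d => ⟪d, ν⟫_ℝ = 0 ∧ ∀ x ∈ X, dist q x = 1 → ⟪x - q, d⟫_ℝ ≤ c).card : ℝ)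
    with hf
  have hkey : ∀ q ∈ X \ P, 12 + 2 * f q ≤ 2 * cP q + dF q + S q := by
    intro q hq
    have hK := perBall_capAccount_ge X P hX hPX U hU hUneg hUcard ν q hq
    set T := ∑ x ∈ (X \ P).filter (fun x => dist q x = 1), t x q with hT
    rw [← hc] at hK
    have hK' := (Int.cast_le (R := ℝ)).2 hK
    simp only [hcP, hdF, hS, hf, ← hT]
    push_cast at hK' ⊢
    linarith
  have hs0 : ∑ q ∈ X \ P, S q = 0 := by
    simp only [hS]
    rw [← Int.cast_sum, sum_sum_transfer_eq_zero (X \ P) t ht_anti, Int.cast_zero]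
  have hcross : ((((P ×ˢ (X \ P)).filter fun pq => dist pq.1 pq.2 = 1).card : ℕ) : ℝ) =
      ∑ q ∈ X \ P, cP q := card_cross_eq_sum_card_plug_partners P (X \ P)
  have hord : (orderedContacts (X \ P) : ℝ) = ∑ q ∈ X \ P, dF q :=
    orderedContacts_eq_sum_card_partners (X \ P)
  have hdef : contactDeficiency (X \ P) =
      6 * ((X \ P).card : ℝ) - (orderedContacts (X \ P) : ℝ) / 2 := rfl
  have hsumkey : ∑ q ∈ X \ P, (12 + 2 * f q) ≤ ∑ q ∈ X \ P, (2 * cP q + dF q + S q) :=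
    sum_le_sum hkey
  simp only [sum_add_distrib, sum_const, nsmul_eq_mul, ← mul_sum] at hsumkey
  rw [hcross, hdef, hord]
  have hfsum : ∑ q ∈ X \ P, f q = ∑ q ∈ X \ P,
      (((P.filter fun p => dist q p = 1 ∧ ∀ d ∈ U, ⟪p - q, d⟫_ℝ ≤ Real.sqrt 3 / 2).card : ℝ)
        + (((X \ P).filter fun x => dist q x = 1 ∧ (∀ d ∈ U, ⟪x - q, d⟫_ℝ ≤ Real.sqrt 3 / 2) ∧
            ⟪x, ν⟫_ℝ < ⟪q, ν⟫_ℝ).card : ℝ)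
        + (1 / 2) * (((X \ P).filter fun x => dist q x = 1 ∧ (∀ d ∈ U, ⟪x - q, d⟫_ℝ ≤ Real.sqrt 3 / 2) ∧
            ⟪x, ν⟫_ℝ = ⟪q, ν⟫_ℝ).card : ℝ)
        - ((U.filter fun d => ⟪d, ν⟫_ℝ < 0 ∧
            ∀ x ∈ X, dist q x = 1 → ⟪x - q, d⟫_ℝ ≤ Real.sqrt 3 / 2).card : ℝ)
        - (1 / 2) * ((U.filter fun d => ⟪d, ν⟫_ℝ = 0 ∧
            ∀ x ∈ X, dist q x = 1 → ⟪x - q, d⟫_ℝ ≤ Real.sqrt 3 / 2).card : ℝ)) := by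
    rfl
  rw [← hfsum]
  linarith [hsumkey, hs0]

end Summit.Ventures.Crystal3D.Theorems

end
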